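import Mathlib
import Summits.Ventures.HodgeRepro.Tier4.Line1.HeckeFinitenessType

/-!
# Tier4/Line1/LeftTypeOfMatrixCoeff — (S1b-INST): a LEVEL FUNCTION TIMES A MATRIX COEFFICIENT has a finite-rank
left-`K`-type, so Hecke finiteness (S1b) is a THEOREM for such test pairs

Blind re-derivation cell `pub-hodge-repro`, Tier 4 (README §9–§10), seat t4-L1-p2 (gen 4), LINE L1.  Target tree path
`lean/Summits/Ventures/HodgeRepro/Tier4/Line1/LeftTypeOfMatrixCoeff.lean`.  Imports t4-L1-p1 g3's `HeckeFinitenessType`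
(p682171: `exists_finset_specBlock_support_of_finiteRank`, `finiteRank_of_left_invariant`) and through it the generic RTF
layer (`RTF.Setting`, `IsTest`, `specBlock`).

WHAT THIS IS.  The (S1b) clause of L1's residual reads (CENSUS v14 §B (5), t4-L1-p1 S13627): «each first test function
`(tf γ).1` of a Hecke choice has a finite-rank left-`K γ`-decomposition `f₁ (k⁻¹ g) = ∑ i, e i k * c i g` (`c i` test
functions) for an OPEN subgroup `K γ`» — the honest shape of a test function of level `K_f` and archimedean type `σ`.
This file shows the clause is MET by the natural class of such functions:

* `HasFiniteRankLeftType K f` — the ∃-packaging of p1's `(e, c, hc, hdec)`; closed under sums, scalars and finite sums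
  (`HasFiniteRankLeftType.add` / `.const_mul` / `.finset_sum`), and containing the left-`K`-invariant test functions
  (`.of_left_invariant`, rank `1` — p1's `finiteRank_of_left_invariant`);
* `coeffFn A i j ψ := fun g => ψ g * A g i j` — a «level function» `ψ` times the `(i, j)` MATRIX COEFFICIENT of a
  matrix-valued homomorphism `A : G →* Matrix (Fin d) (Fin d) ℂ` (= a finite-dimensional representation of `G` in a
  basis: `A g i j` is the coefficient `⟨ρ(g) e_j, e_i^*⟩`).  THEOREM `coeffFn_inv_mul`: when `ψ` is left-`K`-invariant,
  `coeffFn A i j ψ (k⁻¹ g) = ∑ l, A k⁻¹ i l * coeffFn A l j ψ g` — `map_mul` and `Matrix.mul_apply`: rank `d`,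
  `e l k := A k⁻¹ i l` (the matrix coefficients of `ρ` on `K`), `c l := coeffFn A l j ψ` (test functions when `ψ` is
  one and the entries of `A` are continuous: `isTest_coeffFn`); hence `hasFiniteRankLeftType_coeffFn`;
* the CONSUMERS, over every `RTF.Setting G`: `exists_finset_specBlock_support_of_hasFiniteRankLeftType` (p1's theorem on
  the packaged predicate) and `exists_finset_specBlock_support_of_matrixCoeff` — for an OPEN `K`, a left-`K`-invariant
  test function `ψ` and a matrix-valued homomorphism `A` with continuous entries, only finitely many blocks of the spectral
  expansion of `J (coeffFn A i j ψ ⋆ f₂)` are non-zero: (S1b) is a THEOREM for such pairs.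

On L1's instance (`G = U(W)(𝔸_k)`, the definite seesaw plane) the intended `A` is the archimedean standard representation
at an infinite place and `K = K_f(N) × G(k_∞)` (the companion module `ArchMatrixCoeff`); `ψ` = the characteristic function
of a double coset `K g₀ K` is a test function exactly when `G(k_∞)` is compact — NOT claimed here: `ψ` stays a binder.

JUNK TESTS.  `d = 0`: `coeffFn A i j ψ` has no `i j` (`Fin 0` is empty) — vacuous.  `K = ⊤`: a left-`⊤`-invariant
`ψ` is constant, a test function only on a compact `G` — the open-`K` hypotheses of the consumers are exactly p1's.
`A = 1` (the trivial representation, `d = 1`): `coeffFn 1 0 0 ψ = ψ`, rank `1`, `e = 1` — p1's invariant case.  No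
hypothesis is vacuous on the instance: `ψ := 1_K` for a compact open `K` is a left-`K`-invariant test function.

NOT claimed: the seesaw identity (S1a), the dictionary `tf` (which Hecke translate gives which pair), the isolation
(S3′), compactness of any archimedean factor, or `P_T4`.  0 print.  Nothing here says anything about the status of the
Hodge conjecture for CM abelian varieties, which is NOT proved (HC_CM is NOT proved by anyone in this repository).
-/

set_option autoImplicit false

noncomputable section

namespace Summit.Ventures.HodgeRepro.Tier4.Line1

open MeasureTheory Topology

namespace RTF

variable {G : Type} [Group G] [TopologicalSpace G]

section FiniteRankLeftType

variable (K : Subgroup G)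

/-- **a finite-rank left-`K`-type** (the ∃-packaging of t4-L1-p1's `(e, c, hc, hdec)`, HeckeFinitenessType p682171):
`f (k⁻¹ g) = ∑ i, e i k * c i g` for some rank `r`, coefficient functions `e i : K → ℂ` and TEST functions `c i`. -/
def HasFiniteRankLeftType (f : G → ℂ) : Prop :=
  ∃ (r : ℕ) (e : Fin r → K → ℂ) (c : Fin r → G → ℂ), (∀ i, IsTest (c i)) ∧
    ∀ (k : K) (g : G), f ((k : G)⁻¹ * g) = ∑ i, e i k * c i g

variable {K}

/-- a left-`K`-invariant test function has a finite-rank left-`K`-type (rank `1`, `e = 1`, `c = f`: p1's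
`finiteRank_of_left_invariant`). -/
theorem HasFiniteRankLeftType.of_left_invariant {f : G → ℂ} (hf : IsTest f)
    (hinv : ∀ k ∈ K, ∀ g, f (k * g) = f g) : HasFiniteRankLeftType K f :=
  ⟨1, fun _ _ => 1, fun _ => f, fun _ => hf, Setting.finiteRank_of_left_invariant K hinv⟩

/-- the zero function has a finite-rank left-`K`-type (rank `0`). -/
theorem HasFiniteRankLeftType.zero : HasFiniteRankLeftType K (fun _ : G => (0 : ℂ)) :=
  ⟨0, fun i => Fin.elim0 i, fun i => Fin.elim0 i, fun i => Fin.elim0 i, fun _ _ => by simp⟩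

/-- finite-rank left-`K`-types are closed under sums (the ranks add). -/
theorem HasFiniteRankLeftType.add {f f' : G → ℂ} (hf : HasFiniteRankLeftType K f)
    (hf' : HasFiniteRankLeftType K f') : HasFiniteRankLeftType K (fun g => f g + f' g) := by
  obtain ⟨r, e, c, hc, hdec⟩ := hf
  obtain ⟨r', e', c', hc', hdec'⟩ := hf'
  refine ⟨r + r', Fin.append e e', Fin.append c c', ?_, ?_⟩
  · intro i
    refine Fin.addCases (fun i => ?_) (fun i => ?_) i
    · simpa using hc i
    · simpa using hc' i
  · intro k g
    simp only
    rw [hdec k g, hdec' k g, Fin.sum_univ_add]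
    simp

/-- finite-rank left-`K`-types are closed under scalar multiples. -/
theorem HasFiniteRankLeftType.const_mul {f : G → ℂ} (hf : HasFiniteRankLeftType K f) (a : ℂ) :
    HasFiniteRankLeftType K (fun g => a * f g) := by
  obtain ⟨r, e, c, hc, hdec⟩ := hf
  refine ⟨r, fun i k => a * e i k, c, hc, fun k g => ?_⟩
  simp only
  rw [hdec k g, Finset.mul_sum]
  exact Finset.sum_congr rfl fun i _ => by ring

/-- finite-rank left-`K`-types are closed under finite sums. -/
theorem HasFiniteRankLeftType.finset_sum {ι : Type} (F : Finset ι) (f : ι → G → ℂ)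
    (hf : ∀ i ∈ F, HasFiniteRankLeftType K (f i)) :
    HasFiniteRankLeftType K (fun g => ∑ i ∈ F, f i g) := by
  classical
  induction F using Finset.induction_on with
  | empty => simpa using HasFiniteRankLeftType.zero (K := K)
  | insert a F ha ih =>
    have h1 : HasFiniteRankLeftType K (f a) := hf a (Finset.mem_insert_self a F)
    have h2 : HasFiniteRankLeftType K (fun g => ∑ i ∈ F, f i g) :=
      ih fun i hi => hf i (Finset.mem_insert_of_mem hi)
    simpa [Finset.sum_insert ha] using h1.add h2

end FiniteRankLeftType

section MatrixCoeff

variable (K : Subgroup G) {d : ℕ} (A : G →* Matrix (Fin d) (Fin d) ℂ) (i j : Fin d) (ψ : G → ℂ)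

/-- **a level function times a matrix coefficient**: `g ↦ ψ g * A g i j`, the `(i, j)` coefficient of the matrix-valued
homomorphism `A` (a finite-dimensional representation of `G` written in a basis) weighted by `ψ`. -/
def coeffFn : G → ℂ := fun g => ψ g * A g i j

omit [TopologicalSpace G] in
/-- **the finite-rank left-`K`-decomposition of a matrix coefficient**: for a left-`K`-invariant `ψ`,
`coeffFn A i j ψ (k⁻¹ g) = ∑ l, A k⁻¹ i l * coeffFn A l j ψ g` (`A (k⁻¹ g) = A k⁻¹ * A g` and `Matrix.mul_apply`). -/
theorem coeffFn_inv_mul (hψ : ∀ k ∈ K, ∀ g, ψ (k * g) = ψ g) (k : K) (g : G) :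
    coeffFn A i j ψ ((k : G)⁻¹ * g) = ∑ l : Fin d, A (k : G)⁻¹ i l * coeffFn A l j ψ g := by
  simp only [coeffFn]
  rw [hψ _ (K.inv_mem k.2) g, map_mul, Matrix.mul_apply, Finset.mul_sum]
  exact Finset.sum_congr rfl fun l _ => by ring

/-- a level function times a matrix coefficient is a test function when the level function is one and the
coefficient is continuous. -/
theorem isTest_coeffFn (hψ : IsTest ψ) (hA : Continuous fun g => A g i j) : IsTest (coeffFn A i j ψ) :=
  ⟨hψ.cont.mul hA, hψ.compact.mul_right⟩

/-- **a level function times a matrix coefficient has a finite-rank left-`K`-type** (rank `d`,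
`e l k = A k⁻¹ i l`, `c l = coeffFn A l j ψ`). -/
theorem hasFiniteRankLeftType_coeffFn (hψ : IsTest ψ) (hψK : ∀ k ∈ K, ∀ g, ψ (k * g) = ψ g)
    (hA : ∀ l j, Continuous fun g => A g l j) : HasFiniteRankLeftType K (coeffFn A i j ψ) :=
  ⟨d, fun l k => A (k : G)⁻¹ i l, fun l => coeffFn A l j ψ, fun l => isTest_coeffFn A l j ψ hψ (hA l j),
    coeffFn_inv_mul K A i j ψ hψK⟩

end MatrixCoeff

namespace Setting

variable [IsTopologicalGroup G] [MeasurableSpace G] [BorelSpace G] (S : Setting G)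
variable (χ : S.T → ℂ) (χ' : S.T' → ℂ) (φ : ℕ → G → ℂ) (n : ℕ → ℕ) (f₁ f₂ : G → ℂ) (K : Subgroup G)

/-- **HECKE FINITENESS FOR A FINITE-RANK LEFT-`K`-TYPE, packaged**: for an open `K` and a test function `f₁` with
`HasFiniteRankLeftType K f₁`, only finitely many blocks of the spectral expansion of `J (f₁ ⋆ f₂)` are non-zero
(t4-L1-p1's `exists_finset_specBlock_support_of_finiteRank` on the unpacked data). -/
theorem exists_finset_specBlock_support_of_hasFiniteRankLeftType [Countable S.Gk] (hK : IsOpen (K : Set G))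
    {τ : ℕ → Set (G → ℂ)} (hB : S.IsAdaptedONB τ φ n) (h₁ : IsTest f₁) (hf : HasFiniteRankLeftType K f₁) :
    ∃ s : Finset ℕ, ∀ m ∉ s, specBlock S χ χ' φ n f₁ f₂ m = 0 := by
  obtain ⟨r, e, c, hc, hdec⟩ := hf
  exact S.exists_finset_specBlock_support_of_finiteRank χ χ' φ n f₁ f₂ K hK hB h₁ e c hc hdec

/-- **(S1b) FOR A LEVEL FUNCTION TIMES A MATRIX COEFFICIENT** (the theorem of record of this file): for an OPEN `K`, a
left-`K`-invariant test function `ψ`, a matrix-valued homomorphism `A : G →* Matrix (Fin d) (Fin d) ℂ` with continuous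
entries and any `i j`, the test pair `(coeffFn A i j ψ, f₂)` has a FINITE spectrum: `∃ s : Finset ℕ`, every block
`m ∉ s` of `J (coeffFn A i j ψ ⋆ f₂)` vanishes. -/
theorem exists_finset_specBlock_support_of_matrixCoeff [Countable S.Gk] (hK : IsOpen (K : Set G))
    {τ : ℕ → Set (G → ℂ)} (hB : S.IsAdaptedONB τ φ n) {d : ℕ} (A : G →* Matrix (Fin d) (Fin d) ℂ) (i j : Fin d)
    {ψ : G → ℂ} (hψ : IsTest ψ) (hψK : ∀ k ∈ K, ∀ g, ψ (k * g) = ψ g)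
    (hA : ∀ l j, Continuous fun g => A g l j) :
    ∃ s : Finset ℕ, ∀ m ∉ s, specBlock S χ χ' φ n (coeffFn A i j ψ) f₂ m = 0 :=
  S.exists_finset_specBlock_support_of_hasFiniteRankLeftType χ χ' φ n (coeffFn A i j ψ) f₂ K hK hB
    (isTest_coeffFn A i j ψ hψ (hA i j)) (hasFiniteRankLeftType_coeffFn K A i j ψ hψ hψK hA)

/-- the finite block support of a level function times a matrix coefficient, as a `Set.Finite`. -/
theorem finite_specBlock_support_of_matrixCoeff [Countable S.Gk] (hK : IsOpen (K : Set G))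
    {τ : ℕ → Set (G → ℂ)} (hB : S.IsAdaptedONB τ φ n) {d : ℕ} (A : G →* Matrix (Fin d) (Fin d) ℂ) (i j : Fin d)
    {ψ : G → ℂ} (hψ : IsTest ψ) (hψK : ∀ k ∈ K, ∀ g, ψ (k * g) = ψ g)
    (hA : ∀ l j, Continuous fun g => A g l j) :
    {m : ℕ | specBlock S χ χ' φ n (coeffFn A i j ψ) f₂ m ≠ 0}.Finite := by
  obtain ⟨s, hs⟩ := S.exists_finset_specBlock_support_of_matrixCoeff χ χ' φ n f₂ K hK hB A i j hψ hψK hA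
  exact s.finite_toSet.subset fun m hm => by
    by_contra hms
    exact hm (hs m hms)

end Setting

end RTF

end Summit.Ventures.HodgeRepro.Tier4.Line1

end
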